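import Mathlib
import Literature.Geometry.Lorentzian.LorentzianMetric
import Literature.Geometry.Lorentzian.ImmersionChartMetric
import Literature.Geometry.Lorentzian.ChartConnection
import Literature.Geometry.Lorentzian.KerrSchild
import Literature.Geometry.Lorentzian.BoundedGeometry

/-!
# Route PhotonSphereChannels · crux `TameCensorship` (stmt-FinalStateConjecture-17431) · line `Sketch` ·
# stub `stub_pinnedBall_of_normalChart`: a chart normalised to `η` at a point is pinned on a ball

Helper file (`--supports stmt-FinalStateConjecture-17431`) of line `Sketch` (lead c2, 2026-08-17, wave 4), a brick
of the PANCAKE LAW on the compact initial segment of a null geodesic. The lever reads the geodesic in charts whose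
metric components `G` are PINNED to the Minkowski form (`‖G − η‖ ≤ ½`) with bounded first and second derivatives.
At a point of the initial segment another brick produces an immersion chart `Ψ : O → 𝓢` (`O : Opens E4`, `0 ∈ O`)
whose transported metric `Ψ^* g` equals `η` AT `0`; this file is the pure-analysis step: the total representative
`G = ImmersionChart.repr` of `Ψ^* g` is `C^∞` on `O` (`ImmersionChart.isMetricOn_repr`) and equals `η` at `0`
(`ImmersionChart.metric_val_eq_repr`), so by continuity `‖G − η‖ < ½` on a ball `B(0, ρ₁) ⊆ O`, and on the
compact closed ball of radius `ρ = ρ₁ / 2` the continuous maps `DG`, `D²G`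
(`contDiffOn_infty_iff_fderiv_of_isOpen`) have bounded operator norms (`IsCompact.exists_bound_of_continuousOn`),
which gives the applied bounds `‖DG(z) v‖ ≤ L ‖v‖`, `‖D²G(z)(v, w)‖ ≤ L ‖v‖ ‖w‖` on `B(0, ρ)`.

References: B. O'Neill, *Semi-Riemannian Geometry* (1983), Ch. 3, pp. 90–91 (transported metric); the rest is
elementary calculus in a finite-dimensional normed space.
-/

set_option linter.dupNamespace false

-- norms of the nested operator type `E4 →L[ℝ] E4 →L[ℝ] ℝ` and its derivatives need a deeper instance search
set_option maxSynthPendingDepth 3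

open Literature.Geometry.Lorentzian
open scoped Manifold ContDiff Topology

noncomputable section

namespace Summit.FinalStateConjecture.FinalStateConjecture.Theorems.PhotonSphereChannels.TameCensorshipUnwind

/-- **The pin near a point of normalisation.** If `G : E4 → (E4 →L E4 →L ℝ)` is `C^∞` on an open `O ∋ 0` and
`G 0 = η`, then `‖G z − η‖ < ½` on some ball `B(0, ρ₁) ⊆ O` (continuity of `G` at `0`,
`NormedAddCommGroup.tendsto_nhds_nhds`, and `Metric.isOpen_iff`). [folklore] -/
private theorem pinnedBall_norm_sub_bilin_lt {G : E4 → E4 →L[ℝ] E4 →L[ℝ] ℝ} {O : Set E4}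
    (hO : IsOpen O) (h0 : (0 : E4) ∈ O) (hG : ContDiffOn ℝ ∞ G O) (hG0 : G 0 = Minkowski.bilin) :
    ∃ ρ₁ : ℝ, 0 < ρ₁ ∧ Metric.ball (0 : E4) ρ₁ ⊆ O ∧ ∀ z ∈ Metric.ball (0 : E4) ρ₁,
      ‖G z - Minkowski.bilin‖ < 1 / 2 := by
  have hcont : ContinuousAt G 0 := hG.continuousOn.continuousAt (hO.mem_nhds h0)
  obtain ⟨δ, hδ, hδG⟩ := NormedAddCommGroup.tendsto_nhds_nhds.1 hcont (1 / 2) (by norm_num)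
  obtain ⟨ε, hε, hεO⟩ := Metric.isOpen_iff.1 hO 0 h0
  refine ⟨min δ ε, lt_min hδ hε, (Metric.ball_subset_ball (min_le_right δ ε)).trans hεO, fun z hz ↦ ?_⟩
  have hzδ : ‖z - 0‖ < δ := by
    rw [sub_zero, ← dist_zero_right]
    exact Metric.ball_subset_ball (min_le_left δ ε) hz
  have h := hδG z hzδ
  rwa [hG0] at h

/-- **Uniform first and second derivative bounds on a compact ball.** If `G` is `C^∞` on an open `O` containing the
closed ball `B̄(0, ρ)`, then `DG` and `D²G` (both `C^∞` on `O`, `contDiffOn_infty_iff_fderiv_of_isOpen`, hence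
continuous) have operator norms bounded on the compact `B̄(0, ρ)` (`IsCompact.exists_bound_of_continuousOn`),
whence the applied bounds `‖DG(z) v‖ ≤ L ‖v‖` and `‖D²G(z)(v, w)‖ ≤ L ‖v‖ ‖w‖` (`ContinuousLinearMap.le_opNorm`).
[folklore] -/
private theorem pinnedBall_fderiv_bounds_of_closedBall_subset {G : E4 → E4 →L[ℝ] E4 →L[ℝ] ℝ} {O : Set E4}
    (hO : IsOpen O) (hG : ContDiffOn ℝ ∞ G O) {ρ : ℝ} (hρO : Metric.closedBall (0 : E4) ρ ⊆ O) :
    ∃ L : ℝ, ∀ z ∈ Metric.closedBall (0 : E4) ρ,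
      (∀ v : E4, ‖fderiv ℝ G z v‖ ≤ L * ‖v‖) ∧
      (∀ v w : E4, ‖fderiv ℝ (fderiv ℝ G) z v w‖ ≤ L * ‖v‖ * ‖w‖) := by
  have hG₁ : ContDiffOn ℝ ∞ (fderiv ℝ G) O := ((contDiffOn_infty_iff_fderiv_of_isOpen hO).1 hG).2
  have hG₂ : ContDiffOn ℝ ∞ (fderiv ℝ (fderiv ℝ G)) O :=
    ((contDiffOn_infty_iff_fderiv_of_isOpen hO).1 hG₁).2
  have hK : IsCompact (Metric.closedBall (0 : E4) ρ) := isCompact_closedBall 0 ρ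
  have hc₁ : ContinuousOn (fderiv ℝ G) (Metric.closedBall (0 : E4) ρ) := hG₁.continuousOn.mono hρO
  have hc₂ : ContinuousOn (fderiv ℝ (fderiv ℝ G)) (Metric.closedBall (0 : E4) ρ) :=
    hG₂.continuousOn.mono hρO
  obtain ⟨L₁, hL₁⟩ := hK.exists_bound_of_continuousOn (f := fderiv ℝ G) hc₁
  obtain ⟨L₂, hL₂⟩ := hK.exists_bound_of_continuousOn (f := fderiv ℝ (fderiv ℝ G)) hc₂
  refine ⟨max L₁ L₂, fun z hzc ↦ ?_⟩
  have hD₁ : ‖fderiv ℝ G z‖ ≤ max L₁ L₂ := (hL₁ z hzc).trans (le_max_left _ _)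
  have hD₂ : ‖fderiv ℝ (fderiv ℝ G) z‖ ≤ max L₁ L₂ := (hL₂ z hzc).trans (le_max_right _ _)
  refine ⟨fun v ↦ ?_, fun v w ↦ ?_⟩
  · exact (ContinuousLinearMap.le_opNorm _ v).trans (mul_le_mul_of_nonneg_right hD₁ (norm_nonneg v))
  · have h1 : ‖fderiv ℝ (fderiv ℝ G) z v w‖ ≤ ‖fderiv ℝ (fderiv ℝ G) z v‖ * ‖w‖ :=
      ContinuousLinearMap.le_opNorm _ w
    have h2 : ‖fderiv ℝ (fderiv ℝ G) z v‖ ≤ ‖fderiv ℝ (fderiv ℝ G) z‖ * ‖v‖ :=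
      ContinuousLinearMap.le_opNorm _ v
    exact h1.trans (mul_le_mul_of_nonneg_right (h2.trans (mul_le_mul_of_nonneg_right hD₂ (norm_nonneg v)))
      (norm_nonneg w))

/-- **The analysis step.** If `G : E4 → (E4 →L E4 →L ℝ)` is `C^∞` on an open `O ∋ 0` and `G 0 = η`, then on some
ball `B(0, ρ) ⊆ O` the components are pinned, `‖G z − η‖ ≤ ½`, and `DG`, `D²G` obey uniform applied bounds
`‖DG(z) v‖ ≤ L ‖v‖`, `‖D²G(z)(v, w)‖ ≤ L ‖v‖ ‖w‖`: take the pin ball `B(0, ρ₁)` of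
`pinnedBall_norm_sub_bilin_lt` and `ρ = ρ₁ / 2`, so that `B(0, ρ) ⊆ B̄(0, ρ) ⊆ B(0, ρ₁) ⊆ O` and
`pinnedBall_fderiv_bounds_of_closedBall_subset` applies on `B̄(0, ρ)`. [folklore] -/
private theorem pinnedBall_of_contDiffOn_of_eq_bilin {G : E4 → E4 →L[ℝ] E4 →L[ℝ] ℝ} {O : Set E4}
    (hO : IsOpen O) (h0 : (0 : E4) ∈ O) (hG : ContDiffOn ℝ ∞ G O) (hG0 : G 0 = Minkowski.bilin) :
    ∃ ρ : ℝ, 0 < ρ ∧ Metric.ball (0 : E4) ρ ⊆ O ∧ ∃ L : ℝ, ∀ z ∈ Metric.ball (0 : E4) ρ,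
      ‖G z - Minkowski.bilin‖ ≤ 1 / 2 ∧
      (∀ v : E4, ‖fderiv ℝ G z v‖ ≤ L * ‖v‖) ∧
      (∀ v w : E4, ‖fderiv ℝ (fderiv ℝ G) z v w‖ ≤ L * ‖v‖ * ‖w‖) := by
  obtain ⟨ρ₁, hρ₁, hball_O, hpin⟩ := pinnedBall_norm_sub_bilin_lt hO h0 hG hG0
  have hρρ₁ : ρ₁ / 2 < ρ₁ := half_lt_self hρ₁
  have hcb_ball : Metric.closedBall (0 : E4) (ρ₁ / 2) ⊆ Metric.ball (0 : E4) ρ₁ :=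
    Metric.closedBall_subset_ball hρρ₁
  obtain ⟨L, hL⟩ := pinnedBall_fderiv_bounds_of_closedBall_subset hO hG (hcb_ball.trans hball_O)
  refine ⟨ρ₁ / 2, half_pos hρ₁, (Metric.ball_subset_ball hρρ₁.le).trans hball_O, L, fun z hz ↦ ?_⟩
  have hzc : z ∈ Metric.closedBall (0 : E4) (ρ₁ / 2) := Metric.ball_subset_closedBall hz
  exact ⟨(hpin z (hcb_ball hzc)).le, (hL z hzc).1, (hL z hzc).2⟩

/-- **A chart normalised to `η` at a point is pinned, with bounded first and second derivatives of its components,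
on a coordinate ball around the point.** For an immersion chart `Ψ : O → 𝓢` of a spacetime from `O : Opens E4` with
`0 ∈ O` whose transported metric satisfies `(Ψ^* g)_0 = η`, there are `ρ > 0` with `B(0, ρ) ⊆ O` and `L` such that
the representative `G = ImmersionChart.repr` of `Ψ^* g` satisfies `‖G z − η‖ ≤ ½`, `‖DG(z) v‖ ≤ L ‖v‖` and
`‖D²G(z)(v, w)‖ ≤ L ‖v‖ ‖w‖` for all `z ∈ B(0, ρ)` (`G` is `C^∞` on `O`, `ImmersionChart.isMetricOn_repr`, and
`G 0 = η`, `ImmersionChart.metric_val_eq_repr`; then `pinnedBall_of_contDiffOn_of_eq_bilin`). [folklore] -/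
theorem stub_pinnedBall_of_normalChart :
    ∀ (𝓢 : Spacetime.{0} 4) (O : TopologicalSpace.Opens E4) (h0 : (0 : E4) ∈ O) (Ψ : O → 𝓢.carrier)
    (hΨ : ContMDiff 𝓘(ℝ, E4) (𝓡 4) (∞ + 1) Ψ) (hΨ' : ∀ u, Function.Injective (mfderiv 𝓘(ℝ, E4) (𝓡 4) Ψ u)),
    (∀ v w : E4, (ImmersionChart.metric 𝓢.metric.toPseudoRiemannianMetric hΨ hΨ' rfl).val ⟨0, h0⟩ v w =
      Minkowski.bilin v w) →
    ∃ ρ : ℝ, 0 < ρ ∧ Metric.ball (0 : E4) ρ ⊆ (O : Set E4) ∧ ∃ L : ℝ, ∀ z ∈ Metric.ball (0 : E4) ρ,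
      ‖ImmersionChart.repr 𝓢.metric.toPseudoRiemannianMetric hΨ hΨ' rfl z - Minkowski.bilin‖ ≤ 1 / 2 ∧
      (∀ v : E4, ‖fderiv ℝ (ImmersionChart.repr 𝓢.metric.toPseudoRiemannianMetric hΨ hΨ' rfl) z v‖ ≤ L * ‖v‖) ∧
      (∀ v w : E4, ‖fderiv ℝ (fderiv ℝ (ImmersionChart.repr 𝓢.metric.toPseudoRiemannianMetric hΨ hΨ' rfl)) z v w‖ ≤
        L * ‖v‖ * ‖w‖) := by
  intro 𝓢 O h0 Ψ hΨ hΨ' hη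
  have hmet : MetricCoord.IsMetricOn (ImmersionChart.repr 𝓢.metric.toPseudoRiemannianMetric hΨ hΨ' rfl)
      (O : Set E4) :=
    ImmersionChart.isMetricOn_repr 𝓢.metric.toPseudoRiemannianMetric hΨ hΨ' rfl
  have hG0 : ImmersionChart.repr 𝓢.metric.toPseudoRiemannianMetric hΨ hΨ' rfl 0 = Minkowski.bilin := by
    rw [← ImmersionChart.metric_val_eq_repr 𝓢.metric.toPseudoRiemannianMetric hΨ hΨ' rfl ⟨0, h0⟩]
    ext v w
    exact hη v w
  exact pinnedBall_of_contDiffOn_of_eq_bilin O.isOpen h0 hmet.contDiffOn hG0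

end Summit.FinalStateConjecture.FinalStateConjecture.Theorems.PhotonSphereChannels.TameCensorshipUnwind

end
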